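import Summits.AtomisticToContinuum.Crystallization.Theorems.ThreeConeCertificateSlackRigidityPricedFloorsDefs
import Summits.AtomisticToContinuum.Crystallization.Theorems.PhononSlackCertificatesPeriodicGivenLayeredLayerCake3
import Summits.AtomisticToContinuum.Crystallization.Theorems.MinMeanCycleStackingLockLockedBoxMinimiserLayerSums
import HarnessLib

/-!
# `SlackRigidity` (stmt-AtomisticToContinuum-11960), line `priced-floors-palm-exactification`, stub S3
# (`stub_layeredMeanSelection`), analysis package: continuity of the Lennard-Jones layer energies, part 1

Lead c19, S3 analysis (C1).  The interaction `layerInteraction lennardJones a H δ 1` of a particle with a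
full triangular layer of spacing `a` at signed height `H` and letter offset `δ` (a lattice sum over `ℤ²`,
`BarlowStackingEnergy.lean`) is a continuous function of `(a, H)` on the box
`{47/50 ≤ a ≤ 1, 7/10 ≤ |H|}` of the line (`lms_continuousOn_layerInteraction`, registered sub-goal).

Route: the layer sum is even in the height (`layerInteraction_neg_height`, reflection in the layer
plane), so on the box it is the continuous-on-the-quadrant function
`LockedBoxMinimiser.continuousOn_layerInteraction` (Weierstrass M-test with the corner majorant, landed
for item 12023) composed with the continuous map `(a, H) ↦ (a, |H|)`.  All `[folklore]`.
-/

noncomputable section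

open Filter Set Topology
open scoped BigOperators

namespace Summit.AtomisticToContinuum.Crystallization.Theorems.SlackRigidityPricedFloorsContinuity

open Literature.MathematicalPhysics.StatisticalMechanics
open Summit.AtomisticToContinuum.Crystallization.Theorems.SlackRigidityPricedFloors
open Summit.AtomisticToContinuum.Crystallization.Theorems.LayeredHull

/-! ## Evenness of the layer sum in the height -/

/-- Reflection in the layer plane: `‖layerVec a (−h) δ k i j‖ = ‖layerVec a h δ k i j‖`. [folklore] -/
theorem norm_layerVec_neg_height (a h : ℝ) (δ k i j : ℤ) :
    ‖layerVec a (-h) δ k i j‖ = ‖layerVec a h δ k i j‖ := by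
  rw [norm_layerVec, norm_layerVec]
  congr 1
  ring

/-- **The layer interaction is even in the height.** [folklore] -/
theorem layerInteraction_neg_height (V : ℝ → ℝ) (a h : ℝ) (δ k : ℤ) :
    layerInteraction V a (-h) δ k = layerInteraction V a h δ k := by
  unfold layerInteraction
  exact tsum_congr fun ij => by rw [norm_layerVec_neg_height]

/-- Hence the layer interaction at height `|h|` is the one at height `h`. [folklore] -/
theorem layerInteraction_abs_height (V : ℝ → ℝ) (a h : ℝ) (δ k : ℤ) :
    layerInteraction V a |h| δ k = layerInteraction V a h δ k := by
  rcases abs_choice h with h' | h' <;> rw [h']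
  exact layerInteraction_neg_height V a h δ k

/-! ## (C1) Continuity of the layer interaction in `(a, H)` -/

/-- **(C1), registered sub-goal `lms_continuousOn_layerInteraction`.** For every letter offset `δ`, the
map `(a, H) ↦ layerInteraction lennardJones a H δ 1` is continuous on `{47/50 ≤ a ≤ 1, 7/10 ≤ |H|}`
(Weierstrass M-test on the quadrant `a ≥ 47/50`, `H ≥ 7/10`, transported to negative heights by the
evenness of the layer sum in `H`). [folklore] -/
theorem lms_continuousOn_layerInteraction : ∀ (δ : ℤ), ContinuousOn (fun p : ℝ × ℝ => layerInteraction lennardJones p.1 p.2 δ 1) {p | 47 / 50 ≤ p.1 ∧ p.1 ≤ 1 ∧ 7 / 10 ≤ |p.2|} := by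
  intro δ
  have hg := LockedBoxMinimiser.continuousOn_layerInteraction (a₁ := 47 / 50) (h₁ := 7 / 10)
    (by norm_num) (by norm_num) δ (k := 1) one_ne_zero
  have hφ : Continuous fun p : ℝ × ℝ => (p.1, |p.2|) := by fun_prop
  refine (hg.comp hφ.continuousOn fun p hp => ⟨hp.1, hp.2.2⟩).congr fun p _ => ?_
  simp only [Function.comp_apply]
  exact (layerInteraction_abs_height lennardJones p.1 p.2 δ 1).symm

/-- Pointwise form of (C1): continuity within the box at each of its points. [folklore] -/
theorem continuousWithinAt_layerInteraction (δ : ℤ) {p : ℝ × ℝ} (ha : 47 / 50 ≤ p.1) (ha1 : p.1 ≤ 1)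
    (hH : 7 / 10 ≤ |p.2|) :
    ContinuousWithinAt (fun p : ℝ × ℝ => layerInteraction lennardJones p.1 p.2 δ 1)
      {p | 47 / 50 ≤ p.1 ∧ p.1 ≤ 1 ∧ 7 / 10 ≤ |p.2|} p :=
  lms_continuousOn_layerInteraction δ p ⟨ha, ha1, hH⟩

end Summit.AtomisticToContinuum.Crystallization.Theorems.SlackRigidityPricedFloorsContinuity

end
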